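import Literature.NumberTheory.EllipticCurves.PAdicBSD
import Literature.Barriers.BirchSwinnertonDyer.ExceptionalZero
import HarnessLib

/-!
# Spieß 2014, Theorem 5.7 — the WEAK exceptional-zero formula at a split multiplicative prime, `F = ℚ`, `r = 1` (named fact)

Topic `Literature/NumberTheory/EllipticCurves` (cluster `Spiess2014`). ONE named fact (nothing asserted)
and two proved bookkeeping lemmas; no other content. HONEST FRAMING (cell `bsd-2adic`, seat
`bsd-2adic-mult-gs-c`, PROGRAMME v1 T5 road C, 2026-08-26): the cell's mult-at-`2` doors consume the
Greenberg–Stevens identity `greenberg_stevens W 2` (`PAdicBSD.lean`, bsd.S24), whose VERBATIM printed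
proofs keep `p` odd (Greenberg–Stevens 1993 `p ≥ 5`, Kobayashi 2006 Cor. 4.2 odd `p`); at every prime,
in particular `p = 2`, that identity has statement-inclusive refereed print on two chains —
Barrera Salazar–Dimitrov–Jorza, J. Eur. Math. Soc. 24 (2022) Thm. 7.1, and THIS theorem composed with
Gehrmann–Rosso, Compositio Math. 158 (2022) Thm. 4.1 (iii) — audited at `2` by the cell and ruled by
the referee desk (pub-bsdpct `REFEREE.md` ROUND 405, 2026-08-27: "PRINT (dual chain, audited at 2)";
see the docstring of `greenberg_stevens` and `PAdicBSDGreenbergStevensRecite.lean`). This file records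
the one statement PRINTED VERBATIM at every `p` that the rank-`0` `2`-CONVERSE door at a split
multiplicative `2` actually uses — the vanishing half `L(E,1) = 0 ⇒ L_p'(E,1) = 0` (ROUND 405 R-4:
"PASS — verbatim refereed print, flag-free") — and nothing more: it does NOT identify the
`𝓛`-invariant, it is NOT the Mazur–Tate–Teitelbaum formula, and the `2`-part-of-BSD doors (which
need the valuation of `L_p'(E,1)`) are not served by it.

M. Spieß, *On special zeros of `p`-adic `L`-functions of Hilbert modular forms*, Invent. Math. 196
(2014) 69–138, doi:10.1007/s00222-013-0465-0 (read 2026-08-26 in the author's arXiv version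
arXiv:1207.2289 = hub `paper:arxiv-1207.2289`; section and theorem numbers below are those of that
version — in the journal the numbering is shifted by one section, arXiv Thm. 5.7 = Invent. Math.
Thm. 6.7 and arXiv Thm. 5.10 (b) = Invent. Math. Thm. 6.10 (b), the latter as cited by Gehrmann–Rosso,
Compositio Math. 158 (2022), Introduction: "one can remove the assumptions in the main theorem of [Sp]
(see Theorem 6.10 (b) of loc.cit.)"; the decl name keeps the arXiv number). Standing notation (§4,
"Notation", arXiv p. 14): "`F` denotes a totally real number field of degree `d+1` over `ℚ`" — so
`F = ℚ` (`d = 0`) is included —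
and `p` is a prime number with NO parity or size hypothesis anywhere in §§2–5 except in Prop. 5.9 /
Thm. 5.10 (b) ("Assume that `p ≥ 5` is unramified in `F`"), which concern only the COMPARISON
`𝓛_𝔭(π) = 𝓛_𝔭(E)` of the automorphic with the arithmetic `𝓛`-invariant (deduced there from Mok's
theorem); the `p`-adic `L`-function is `L_p(s, π) := ∫_{𝒢_p} ⟨γ⟩^s μ_π(dγ)` with
`⟨γ⟩^s := exp_p(s · log_p 𝒩(γ))` (Def. 3.11; `𝒩` the cyclotomic character of the Galois group `𝒢_p`
of the maximal abelian extension of `F` unramified outside `p∞`), which converges `2`-adically as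
well (`log_2(ℤ_2^×) ⊆ 4ℤ_2`).

**Theorem 5.7, AS PRINTED** (§5.2 "Main results"). "Let `π ∈ 𝔄_0(G, 2̲, α̲)`. The vanishing order of
`L_p(s, π)` at `s = 0` is at least equal to `r` (i.e. to the number of places `𝔭` of `F` above `p`
with `π_𝔭 ≅ St`). Moreover we have
`L_p^{(r)}(0, π) = r! · ∏_{𝔭 ∈ S₁} 𝓛_𝔭(π) · ∏_{𝔭 ∈ S₂} e(α_𝔭, 1) · L(½, π)`
where `e(α_𝔭, 1) = 2` if `α_𝔭 = -1` and `(1 - 1/α_𝔭)²` if `α_𝔭 ≠ ±1`." Here `𝔄_0(G, 2̲, α̲)` is the set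
of cuspidal automorphic representations of `GL₂(𝔸_F)` of parallel weight `2` which are ordinary at
every `𝔭 ∣ p` with ordinary parameters `α̲` (`π_𝔭 = St` Steinberg iff `α_𝔭 = 1`), `S₁ = {𝔭 ∣ p :
π_𝔭 ≅ St}`, `S₂ = S_p ∖ S₁`, `𝓛_𝔭(π) ∈ ℂ_p` is Spieß's AUTOMORPHIC `𝓛`-invariant (§5.1, defined
through the cohomology of `p`-arithmetic groups with values in extensions of the Steinberg
representation), and both sides live in the rank-`1` space `V_κ` carrying the period (Prop. 4.10
(c)). The measure `μ_π` is characterised by the interpolation property Prop. 4.10 (a):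
`∫_{𝒢_p} χ(γ) μ_π(dγ) = τ(χ) · ∏_{𝔭∣p} e(α_𝔭, χ_𝔭) · L(½, π ⊗ χ)` for every finite-order character
`χ` of `𝒢_p`, with `e(α_𝔭, χ_𝔭) = α_𝔭^{-ord_𝔭 𝔣(χ)}` for `χ` ramified at `𝔭` and `= 1 - α_𝔭 χ(ϖ)⁻¹`
for `χ` unramified at `𝔭` when `α_𝔭 = ±1`. Remark 5.11 (a): "In the case `F = ℚ`, Thm. 5.7 is due
to Darmon" (H. Darmon, *Integration on `ℋ_p × ℋ` and arithmetic applications*, Ann. of Math. 154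
(2001), §3.2; not held by the hub, acquisition request acq-11472) — Spieß's own proof (§§3–5) covers
`F = ℚ` as the case `d = 0`.

**Instance transcribed** (`thm57_weakExceptionalZero_splitMultiplicative_rat`): `F = ℚ`, `E/ℚ` an
elliptic curve with SPLIT multiplicative reduction at the prime `p` (any `p`, in particular `p = 2`),
`π = π_E` (so `π_p = St`, `α_p = 1`, `S₁ = {p}`, `S₂ = ∅`, `r = 1`, `L(½, π_E ⊗ χ) = L(E, χ, 1)`;
`E` is modular — in the tree this is the hypothesis `IsNewformOf W f`). Then Thm. 5.7 reads
`L_p'(0, π_E) = 𝓛_p(π_E) · L(E, 1)`, and in particular **`L(E,1) = 0 ⟹ L_p'(0, π_E) = 0`** whatever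
the value of `𝓛_p(π_E)`. The tree has no automorphic `𝓛`-invariant, so exactly this `𝓛`-free
consequence is recorded, in the tree's `T`-variable currency: for every `L ∈ ℚ_p⟦T⟧` with
`IsSplitMultPAdicLFunctionOf f p L` (bsd.S23: `L ∈ Λ ⊗ ℚ_p`, `L(0) = 0`,
`L(χ(γ_cyc) - 1) = ∑_{a mod p^m} χ(a) [a/p^m]⁺_f` for the even `p`-power-order characters `χ` of
conductor `p^m`, `m ≥ 1`; `γ_cyc = cyclotomicGenerator p = 1 + p`, resp. `5` at `p = 2`),
`[0]⁺_f = 0 ⟹ [T¹] L = 0`, where `[0]⁺_f = L(E,1)/Ω⁺_f` (`ratPlusSymbol f 0`). DICTIONARY (why this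
is an instance and not more): for `F = ℚ`, `𝒢_p = Gal(ℚ(μ_{p^∞})/ℚ) ≅ ℤ_p^×`; by Prop. 4.10 (a) the
scalar measure `μ_π` agrees on every finite-order character, hence on every locally constant
function, with `Ω⁺_f ·` (the Mazur–Tate–Teitelbaum measure `a + p^m ℤ_p ↦ [a/p^m]⁺_f` of MTT §I.10,
`α = a_p = 1`) on even test functions (up to the harmless inversion `χ ↔ χ⁻¹` of conventions, under
which vanishing of the first derivative at the trivial character is invariant); restricted to
`Γ = 1 + p^{e₀}ℤ_p` and written in `T = γ_cyc - 1` this is the unique (MTT §I.12–§I.14, Weierstrass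
preparation; tree fact `existsUnique_isSplitMultPAdicLFunctionOf`) `L` with
`IsSplitMultPAdicLFunctionOf f p L`, with `L_p(s, π_E) = Ω⁺_f · L(γ_cyc^s - 1)` up to the sign
`s ↔ -s`, so `(d/ds)|_{s=0} L_p(s, π_E) = ± Ω⁺_f · log_p(γ_cyc) · [T¹] L` and
`L(½, π_E) = L(E,1) = Ω⁺_f · [0]⁺_f`; `Ω⁺_f ≠ 0`, `log_p γ_cyc ≠ 0`
(`Literature.Barriers.BirchSwinnertonDyer.padicLog_cyclotomicGenerator_ne_zero`). The split
multiplicative hypothesis is carried, as in `greenberg_stevens`, by a Tate parameter datum `Dq`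
(`nonempty_tateParameterData_iff`).
`-- TODO(general form): totally real F, r = #S₁ ≥ 1 Steinberg places, the factor ∏_{S₂} e(α_𝔭,1),
and the identity WITH 𝓛_𝔭(π) once automorphic 𝓛-invariants (Spieß §5.1 / Darmon 2001 §3.2) are in
the tree; the strong form with 𝓛_p(E) = log_p q_E / ord_p q_E is `greenberg_stevens` (bsd.S24).`

**Relation to bsd.S24.** `greenberg_stevens W p` (`[T¹]L · log_p γ_cyc = 𝓛_p(E) · [0]⁺_f`) implies
this fact at every `p` (`thm57_weakExceptionalZero_splitMultiplicative_rat_of_greenberg_stevens`,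
proved below); the converse is false in general (the fact says nothing when `L(E,1) ≠ 0`). The
contrapositive `[T¹]L ≠ 0 ⟹ [0]⁺_f ≠ 0` (`….ratPlusSymbol_zero_ne_zero`) is the ONLY use of
`greenberg_stevens (p := 2)` in the cell's rank-`0` `2`-converse door at a split multiplicative `2`
(`Summit.….Theorems.analyticRank_eq_zero_of_finite_selmer_split_two_of_multEisenstein`), which can
therefore be re-keyed to this printed input; the `2`-part-of-BSD doors (`κ₁`-valuation
`ord₂[T¹]L = ord₂[0]⁺_f + ord₂𝓛₂(E) - 2`) cannot.

What is deliberately NOT here: no definition of `𝓛_𝔭(π)`; no transcription of the identification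
`𝓛_p(π_E) = 𝓛_p(E)` (printed for `p ≥ 5` unramified via Spieß Prop. 5.9 / Mok, Greenberg–Stevens
1993, Bertolini–Darmon–Iovita 2010, Dasgupta–Greenberg 2012, and at EVERY prime `p`, so at `p = 2`,
by Gehrmann–Rosso, Compositio Math. 158 (2022) Thm. 4.1 (iii), `𝓛(π,𝔭) = 𝓛^FM(ρ_{π,𝔭})`, with
`𝓛^FM` of the Tate curve `= log_p q_E / ord_p q_E` by Kummer theory — referee desk pub-bsdpct ROUND
405 R-1/R-3: the corroborating chain of the `p = 2` print of `greenberg_stevens`, the comparison cited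
in "citation form"); that identification is what upgrades this weak form to `greenberg_stevens`, and
it is recorded THERE (docstring of the fact; `PAdicBSDGreenbergStevensRecite.lean`), not restated
here; no non-split or good-reduction statement (there `e(α_p, 1) ≠ 0` and there is no exceptional
zero); no statement over `F ≠ ℚ`.

References: [Spiess2014Invent] Thm. 5.7 (= journal Thm. 6.7), Prop. 4.10, Def. 3.11, Rem. 5.11
(a), §4 Notation; [MazurTateTeitelbaum1986Invent] §I.10, §I.12–§I.14; H. Darmon, Ann. of Math. 154
(2001) §3.2 (attribution for `F = ℚ`, not read); the strong form: [Kobayashi2006DocMath] Cor. 4.2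
(odd `p`) and [GreenbergStevens1993] (`p ≥ 5`) verbatim, and at every `p` [BarreraDimitrovJorza2022]
Thm. 7.1 + Def. 5.3 + Prop. 5.2 and [Spiess2014Invent] Thm. 6.7 with [GehrmannRosso2022] Thm. 4.1
(iii) (pub-bsdpct ROUND 405: "PRINT (dual chain, audited at 2)"; cell files
`run/shared/lean/pub/bsd-2adic/audit/D-AUDIT-hGS-*-at-2.md`).
-/

set_option autoImplicit false

noncomputable section

open scoped Classical MatrixGroups ModularForm

open CongruenceSubgroup WeierstrassCurve Literature.NumberTheory.EllipticCurves
  Literature.NumberTheory.EllipticCurves.ModularForms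

namespace Literature.NumberTheory.EllipticCurves.Spiess2014

variable (W : WeierstrassCurve ℚ) [W.IsElliptic] (p : ℕ) [Fact p.Prime]

/-- **Spieß 2014, Theorem 5.7 at `F = ℚ`, `r = 1` (weak exceptional-zero formula at a split
multiplicative prime; any prime `p`, in particular `p = 2`).** As printed (arXiv:1207.2289 Thm. 5.7 =
Invent. Math. 196 (2014) Thm. 6.7; arXiv numbering throughout, see the module docstring): for `π ∈ 𝔄_0(G, 2̲, α̲)`, `ord_{s=0} L_p(s, π) ≥ r` and
`L_p^{(r)}(0, π) = r! ∏_{𝔭∈S₁} 𝓛_𝔭(π) ∏_{𝔭∈S₂} e(α_𝔭,1) L(½, π)` — no hypothesis on the prime `p`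
(the restriction "`p ≥ 5` unramified in `F`" of Prop. 5.9 / Thm. 5.10 (b) concerns only the
comparison `𝓛_𝔭(π) = 𝓛_𝔭(E)`); for `F = ℚ` "due to Darmon" (Rem. 5.11 (a)). Instance `F = ℚ`,
`π = π_E` for `E/ℚ` (Weierstrass model `W`, newform `f`, `IsNewformOf W f`; like `greenberg_stevens`
the statement needs no minimality of `W`) with split
multiplicative reduction at `p` (Tate datum `Dq`; `π_p = St`, `S₁ = {p}`, `S₂ = ∅`):
`L_p'(0, π_E) = 𝓛_p(π_E) · L(E,1)`, whence, WHATEVER the automorphic `𝓛`-invariant `𝓛_p(π_E)` is,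
`L(E,1) = 0 ⟹ L_p'(E,1) = 0`; in the tree's `T`-variable (dictionary in the module docstring:
Prop. 4.10 (a) identifies `μ_{π_E}` with `Ω⁺_f ·` the Mazur–Tate–Teitelbaum measure, `L` is the
unique bounded interpolant `IsSplitMultPAdicLFunctionOf f p L`, `d/ds ↔ log_p(γ_cyc) · d/dT` with
`log_p γ_cyc ≠ 0`): **`[0]⁺_f = 0 ⟹ [T¹] L = 0`**. Strictly weaker than `greenberg_stevens W p`
(which it follows from, `…_of_greenberg_stevens`); it is the `𝓛`-free content of the printed
theorem, the tree having no automorphic `𝓛`-invariant (`TODO(general form)` in the module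
docstring). Referee desk pub-bsdpct ROUND 405 R-4 (2026-08-27): "PASS — verbatim refereed print, flag-free".
[cite: Spiess2014Invent, Thm. 6.7 (= arXiv:1207.2289 Thm. 5.7; with arXiv Prop. 4.10 (a), Def. 3.11, Rem. 5.11 (a))] -/
def thm57_weakExceptionalZero_splitMultiplicative_rat : Prop :=
  ∀ (_Dq : TateParameterData W p) {N : ℕ} [NeZero N] {f : CuspForm (Gamma0 N) 2} (_hf : IsNewformOf W f)
    {L : PowerSeries ℚ_[p]} (_hL : IsSplitMultPAdicLFunctionOf f p L),
    ratPlusSymbol f 0 = 0 → PowerSeries.coeff 1 L = 0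

variable {W p}

/-- The strong form implies the weak form: from `greenberg_stevens W p`
(`[T¹]L · log_p γ_cyc = 𝓛_p(E) · [0]⁺_f`, bsd.S24) and `[0]⁺_f = 0` we get `[T¹]L · log_p γ_cyc = 0`,
and `log_p γ_cyc ≠ 0` (`Literature.Barriers.BirchSwinnertonDyer.padicLog_cyclotomicGenerator_ne_zero`,
Mazur–Tate–Teitelbaum 1986 §I.13) gives `[T¹]L = 0`. In particular every printed proof of the
strong form (Greenberg–Stevens 1993, `p ≥ 5`; Kobayashi 2006, odd `p`; at every `p` the chains recorded
at `greenberg_stevens`) also yields this fact at those primes.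
[cite: Spiess2014Invent, Thm. 6.7 = arXiv Thm. 5.7 (comparison with the strong form; MTT 1986 §I.13)] -/
theorem thm57_weakExceptionalZero_splitMultiplicative_rat_of_greenberg_stevens
    (h : greenberg_stevens W p) : thm57_weakExceptionalZero_splitMultiplicative_rat W p := by
  intro Dq N _ f hf L hL h0
  obtain ⟨-, h1⟩ := h Dq hf hL
  rw [h0, Rat.cast_zero, mul_zero] at h1
  exact (mul_eq_zero.mp h1).resolve_right
    (Literature.Barriers.BirchSwinnertonDyer.padicLog_cyclotomicGenerator_ne_zero p)

/-- The form in which the cell's rank-`0` `2`-converse door at a split multiplicative prime uses the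
exceptional-zero input (contrapositive of the fact): if `[T¹] L ≠ 0` then `[0]⁺_f ≠ 0`, i.e.
`L(E,1) ≠ 0`. [cite: Spiess2014Invent, Thm. 6.7 = arXiv Thm. 5.7 (contrapositive of the F = ℚ, r = 1 instance)] -/
theorem thm57_weakExceptionalZero_splitMultiplicative_rat.ratPlusSymbol_zero_ne_zero
    (h : thm57_weakExceptionalZero_splitMultiplicative_rat W p) (Dq : TateParameterData W p) {N : ℕ}
    [NeZero N] {f : CuspForm (Gamma0 N) 2} (hf : IsNewformOf W f) {L : PowerSeries ℚ_[p]}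
    (hL : IsSplitMultPAdicLFunctionOf f p L) (h1 : PowerSeries.coeff 1 L ≠ 0) :
    ratPlusSymbol f 0 ≠ 0 :=
  fun h0 ↦ h1 (h Dq hf hL h0)

end Literature.NumberTheory.EllipticCurves.Spiess2014

end
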